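import Literature.MathematicalPhysics.QuantumFieldTheory.Balaban1983to89.B9Cor36DPDsCubeAtLocCfg
import Literature.MathematicalPhysics.QuantumFieldTheory.Balaban1983to89.B9Thm39CinvSandwichQ
import Literature.MathematicalPhysics.QuantumFieldTheory.Balaban1983to89.B9CubeLettersInvReadDict
import Literature.MathematicalPhysics.QuantumFieldTheory.Balaban1983to89.B9Eq3105FamTwoCover

/-!
# `Balaban1983to89.B9Ineq349DPDsYOfEBlock` — (3.49)₄ FOR THE MEMBER LETTER `D_U P(U) D*_U` («DPD* has a regular kernel satisfying (3.49)»): the block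
# majorant `conj b((DPD*)(U₁)^ℝ) ≺ K_P·ℓ(a)⁻²·e^{−ρ·d(a,y)}` over the member's bond carrier `(toB6 (geo9K i) Rr Hp, ιB∘blkV1)`, COMPOSED by r06's typed
# engine `B9Ineq349Hom.ineq349_hom` (conj. 4) from the (3.42) blocks of `G′(U₁)` (`EBlock (kernelFamilySInv …)`), the block-locality of `Q′, Q′*` and a
# (3.48) block majorant of `(Q′G′²Q′*)⁻¹(U₁)` — and, with it, FAMILY 2 OF (3.105) CLOSED modulo those letters (sub-row G-B9-LETTERS, GAPS G-B9-05,
# programme ZETA-2, closing FILE Z2-P; r06 g69 recipe 2026-08-28)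

statement-level skeleton of published theorems with citation tags; proofs where landed; nothing here is a claim about the Yang–Mills mass gap

THE PRINTED LOCUS (verbatim, held `paper:balaban1985-cmp99-background-propagators`, journal page = PDF page + 388).  p. 399 (3.49): «|(DP(U′U)D*)_{μν}(x, x′)|
≦ O(1)(Lʲη)⁻²(L^{j′}η)^{−d} exp(−½δ₀d(y, y′))» (fourth entry); p. 394 (3.25) «Rf = (I − G′Q′*(Q′G′²Q′*)⁻¹Q′G′)f» (last display of p. 394, r06 render p006-x2), p. 414 after
(3.101) «… together with the exponential decay of DPD*»; p. 414 (3.105) (family 2 `(1 − ζ_□̃)DP_□D*h_□G_□h_□`); Thm 3.1 (3.42) p. 397; Thm 3.2 (3.48)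
p. 398; (3.21), (3.24) p. 394 (`Q′`, `Q′*` block-local); [4] (2.51)–(2.55) p. 232 (composition of majorants), Lemma 2.1 (2.60)–(2.61) p. 234, (2.46).
p. 411 (the separation mechanism of family 2, VERBATIM, text layer p0023 l.35–41, r06 g69 render 2026-08-28): «The characteristic function 1 − □̃ at the
beginning of the term, and the function h_□ at the end, restrict a kernel of the term to points separated at least by a distance MLʲη (if □ ∈ 𝒟_j). Hence
the part of the exponential factor can be estimated by e^{−(1∕4)δ₀M} …» — in this file's currency the factor `e^{−a_sep·δ·DsepT i}` of §3 (`DsepT i = M_h∕(2L)`,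
p33 `B9Eq3105ZetaY.DsepT_le_dist_bond`); p. 411 l.11–13 «By the same estimates as in [4], especially (2.83)–(2.85), we can see that the operator R is small».

WHY THIS FILE.  p33's Z2-cover `B9Eq3105FamTwoCover.hasMajorant_sum_famTwo_zetaY_of_eBlock` closed family 2 of (3.105) modulo ONE member input,
`hP : conj b(P^ℝ) ≺ K_P·((geo9K i).len a ^ 2)⁻¹·e^{−a_Pδd}` for the middle letter `P = DPD*(U₁)`.  r06 (22:38:56Z): the letter-free engine for it EXISTS —
`ineq349_hom` (three carriers `X, Y, Z`, conj. 4 = `D∘(G∘Q*∘C∘Q∘G)∘D* ≺ κ₃₄₉·ℓ⁻²·e^{−ρd}`); p38's D2a did the CUBE instantiation (`cor36_P349_cube_at_locCfg`).  THIS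
FILE is the MEMBER instantiation: `X = SiteY × ι` (blocks `ιB∘Δ`), `Y = (Fin(d+1) × SiteY) × ι`, `Z = BlkY × ι` (blocks `ιB`); `G := conj b(η²G′(U₁))` with
its three entries READ OFF `EBlock (kernelFamilySInv i B cfg G′ parS) B_G δ_G U₁` (`B9CubeLettersInvReadDict` entries 0–2 + r06's `B9Eq376DerivDict`);
`Q, Q*` by p21's `hasMajorantHom_conjHom_QpY ∕ _QpsY`; `C := conj b(s·(Q′G′²Q′*)⁻¹(U₁))`, `η⁴s = 1`, with a DISPLAYED (3.48) block majorant (p21 M5.6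
`B9Thm39CinvOfEBlock.hasMajorant_conj_XinvY_of_eBlockInv` supplies it); then the word identity `η²·s·η² = 1`, `DPD* = D∘(G′Q′*X⁻¹Q′G′)∘D*` ((3.25)) and
p38's carrier relabel `hasMajorant_conj_gradMdiv_of_relabel` (`blkV1 f = Δ(f₋)`, rfl).

WHAT THIS FILE CERTIFIES (kernel-checked; 0 `def`, 0 `def … : Prop`, 0 sorry; standard axioms only)

* §1 `id_sub_RY_eq`, `DPDsY_eq_gradY_pWord_divY` ((3.25): `1 − R = G′Q′*X⁻¹Q′G′`), `pHatWordY_eq_conj` (the conjugated word with the η-weights IS `conj b` of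
  the letter word), `inv_etaS_coe_eq` (`η⁻¹ = |c_f|` under the displayed `hη`).
* §2 ★★★ `hasMajorant_conj_DPDsY_of_eBlockInv` — for every member, section, `Rr, Hp`: from `hE : EBlock (kernelFamilySInv i B cfg G′ parS) B_G δ_G U₁`,
  bi-contractive `parS (cfg U₁)`, `hη : etaS i = |c_f|⁻¹`, a (3.48) block majorant `hCinv` of `conj b(s·X⁻¹(U₁))` at rate `δ_X`, a common rate
  `δ ≤ δ_G, δ_X`, (2.61) `Ineq261 dB (toB6 (geo9K i) Rr Hp) δ₀ β` and the three scale transfers of `ℓ, ℓ², ℓ⁻⁴` on `geo9K` (displayed), `ρ + (2α+β)δ₀ ≤ δ`: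
  `conj b((DPDsY i parS G′ (cfg U₁))^ℝ) ≺ κ₃₄₉(M₂Σ‖b_j‖, (d+1)M₂Σ‖b_j‖B_G, B₁, Λ, c₁(δ₀,β))·((geo9K i).len a ^ 2)⁻¹·e^{−ρ·d(a,y)}` over `(toB6 (geo9K i) Rr Hp, ιB∘blkV1)`.
* §3 ★★★ `hasMajorant_sum_famTwo_zetaY_closed` — Z2-cover §3 with `hP` SUPPLIED by §2 at `P := DPDsY i parS G′ (cfg U₁)`: family 2 of (3.105) summed over the
  cover, `≺ Θ₂·e^{−a_sep·δ·DsepT i}·e^{−ρ′δ·d}`, modulo the letters' blocks (`hE` for `G′`, `hEO` for the `O_□`), `hCinv`, `hpar`, `hη`, the member (2.61) ∕ transfers.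
* §4 ★★ `famTwoT_zetaY_eq_zero`, `sum_famTwoT_zetaY_eq_zero`, `hasMajorant_sum_famTwoT_zetaY` — the TRANSPOSED family-2 word of `hV′`,
  `Σ_□ conj b((M_{h_□}·O_□·M_{h_□}·((1 − M_{ζ_□̃})·P))^ℝ)`, is the ZERO operator at the ζ of record (`h_□ζ_□̃ = h_□`), hence has every nonnegative majorant.

HONEST SCOPE ∕ NOT CLAIMED.  (i) The (3.48) majorant of `(Q′G′²Q′*)⁻¹(U₁)` is DISPLAYED (`hCinv`) — it is p21's M5.6 end-to-end theorem under ITS displayed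
data (Thm 3.9's local inverses); (3.42) for `G′(U₁)` is DISPLAYED as `hE` (M5.5 ∕ FRONT A); nothing of Thm 3.1 ∕ 3.2 ∕ 3.9 is re-proved here.  (ii) (2.61) and
the scale transfers on the member geometry are DISPLAYED (p21 ∕ p33 supply them above thresholds: `B9GeoInputsMultiRateKLevelV1`, `scaleTransfer_len_geo9K`).
(iii) `[Fintype (geo9K i).Site]` displayed as everywhere in M5.6 ∕ M5.7.  (iv) NOT here: the knit into `hrest` of `eBlock_kernelFamilyBInv_GAY_of_localInverseCubes''`
(t2s assembler), the smallness `hsmall` (the factor `e^{−a_sep·δ·D_sep}`, `D_sep = M_h∕(2L)`, is where «M sufficiently large» acts).  Count-neutral; NOT a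
node discharge; no summit ∕ sub-problem statement is proved; nothing continuum ∕ OS ∕ mass-gap ∕ Clay; YM mass gap NOT proved (Track A conditional rung).
No `sorry`, no `axiom`, no `… : Prop` fact, no `instance`, no `notation`, no `def`.  NEW file; nothing landed is modified.  Cell `lit-balaban`, seat
`lit-balaban-p33` gen 102, 2026-08-28; `--supports stmt-QuantumFields-19200` as helper.  Net new unproved facts: 0.

RELATED IN THE TREE, NOT DUPLICATED (searched 2026-08-28: `rg 'conj_DPDsY_of'` = ∅; the cube twin is p38 `B9Cor36DPDsCubeAtLocCfg.cor36_P349_cube_at_locCfg`):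
r06 `B9Ineq349Hom.ineq349_hom`, `B9Eq376DerivDict`; p21 `B9Thm39CinvSandwichQ.hasMajorantHom_conjHom_QpY∕_QpsY`, `B9CubeLettersInvReadDict` readers;
p38∕g43 `B9Eq376ProjPieceDictY`, `B9Cor36DPDsCubeAtLocCfg.hasMajorant_conj_gradMdiv_of_relabel`; p33 `B9Eq3105FamTwoCover` — all USED BY NAME.
-/

noncomputable section

namespace Literature.MathematicalPhysics.QuantumFieldTheory.Balaban1983to89.B9Ineq349DPDsYOfEBlock

open NormedSpace Complex
open B6RandomWalk (HasMajorant hasMajorant_mono Ineq261 c1_nonneg Triangle254)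
open B9FromB6 (EBlock)
open B6RandomWalkHom (HasMajorantHom hasMajorantHom_mono)
open B9Thm34Ext (toB6)
open B9Ineq347 (ScaleTransfer)
open B9Eq352DivFormLetters (conj)
open B9Eq352GradLetters (diffLetter)
open B9Eq376POneLetters (conjHom gradLin divLin conjHom_eq_conj conjHom_comp)
open B9Eq376DerivDict (hasMajorantHom_gradLin hasMajorantHom_divLin)
open B9Ineq349Hom (ineq349_hom)
open B9Ineq368PPrime (kappa349)
open B9Ineq368PPrimeDs (kappa349_nonneg)
open B6KLevelCensusIndexV1 (KIdx kGeo)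
open B6Cover236MultiLevelBlocks (cubes)
open B6GlobalChartV1 (blkV1)
open B6Geom246MultiLevelBox (blkOf)
open B6Ineq2142KLevelV1 (β)
open B9GeoNormsKLevelV1 (geo9K)
open B9CubeLettersInvReadDict (hasMajorant_conj_G_of_eBlockInv hasMajorant_gradF_mul_G_of_eBlockInv hasMajorant_G_mul_gradB_of_eBlockInv)
open B9Thm39CinvSandwichQ (hasMajorantHom_conjHom_QpY hasMajorantHom_conjHom_QpsY)
open B9Cor35CinvAtCubeLetters (kernel_rate_mono)
open B9Cor35GCubeInputsAtOne (kGeo_eta)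
open B9Cor36DPDsCubeAtLocCfg (hasMajorant_conj_gradMdiv_of_relabel)
open B9Thm37CubeCoverCommutators (cutMulY hTY)
open B9Thm37GpTorusRegularCubes (SQT)
open B9Thm39CinvAtCover (DsepT)
open B9Eq3104CutoffCommutators (hBdY DPDsY)
open B9Eq3105ZetaY (zetaY)
open B9Eq3105FamTwoCore (geo9K_axioms)
open B9Eq3105FamTwoCover (hasMajorant_sum_famTwo_zetaY_of_eBlock)
open B9CubeLettersInvReadings (kernelFamilySInv kernelFamilyBInv)
open Node00 (SiteY BlkY IBondY FBondY CfgY SiteOpY BondOpY SiteParY toKT etaS shiftY UboxY QpY QpsY XinvY RY gradY divY)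
open Node00.OpsYNablaBridge (chartY)

variable {d ℓ : ℕ} {hd : 1 ≤ d + 1} {hL : Odd (ℓ + 1) ∧ 1 < ℓ + 1} {b₀ b₁ : ℝ}
variable {𝔸 : Type} [NormedRing 𝔸] [NormedAlgebra ℂ 𝔸] [CompleteSpace 𝔸]
variable {ι : Type} [Fintype ι]
variable (i : KIdx d ℓ hd hL b₀ b₁) (b : Module.Basis ι ℝ 𝔸)

/-! ## §1  Algebra: (3.25) for the member letters, the η-weighted conjugated word, `η⁻¹ = |c_f|` -/

section Algebra

variable (parS : SiteParY 𝔸 i) (Gp : SiteOpY 𝔸 i)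

/-- `1 − R(U) = G′(U)Q′*(U)(Q′G′²Q′*)⁻¹(U)Q′(U)G′(U)` — (3.25). [cite: Balaban1985BackgroundPropagators, (3.25) p.394] -/
theorem id_sub_RY_eq (U : CfgY 𝔸 i) :
    LinearMap.id - RY i parS Gp U = Gp U ∘ₗ QpsY i parS U ∘ₗ XinvY i parS Gp U ∘ₗ QpY i parS U ∘ₗ Gp U := by
  rw [RY, sub_sub_cancel]

/-- ★ `DPD*(U) = D_U·(G′Q′*(Q′G′²Q′*)⁻¹Q′G′)(U)·D*_U` — (3.25) inside the member letter `DPDsY`. [cite: Balaban1985BackgroundPropagators, (3.25) p.394, (3.101) p.414] -/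
theorem DPDsY_eq_gradY_pWord_divY (U : CfgY 𝔸 i) :
    DPDsY i parS Gp U = gradY i U ∘ₗ (Gp U ∘ₗ QpsY i parS U ∘ₗ XinvY i parS Gp U ∘ₗ QpY i parS U ∘ₗ Gp U) ∘ₗ divY i U := by
  rw [DPDsY, id_sub_RY_eq]

/-- ★ **THE η-WEIGHTED CONJUGATED WORD IS `conj b` OF THE LETTER WORD**: `conj b(η²G′)∘conĵQ′*∘conj b(s·X⁻¹)∘conĵQ′∘conj b(η²G′) = conj b((G′Q′*X⁻¹Q′G′)^ℝ)` when
`η²·η²·s = 1` ([4] p. 232 «preserved under the composition»; the member twin of g43's `pHatWord_eq_conj`).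
[cite: Balaban1985BackgroundPropagators, (3.25) p.394; Balaban1984PropagatorsII, (2.52)–(2.55) p.232] -/
theorem pHatWordY_eq_conj (U : CfgY 𝔸 i) {η s : ℝ} (hs : (η ^ 2 * η ^ 2) * s = 1) :
    conj b ((η ^ 2) • (Gp U).restrictScalars ℝ) ∘ₗ conjHom b ((QpsY i parS U).restrictScalars ℝ) ∘ₗ
        conj b (s • (XinvY i parS Gp U).restrictScalars ℝ) ∘ₗ conjHom b ((QpY i parS U).restrictScalars ℝ) ∘ₗ
        conj b ((η ^ 2) • (Gp U).restrictScalars ℝ) =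
      conj b ((Gp U ∘ₗ QpsY i parS U ∘ₗ XinvY i parS Gp U ∘ₗ QpY i parS U ∘ₗ Gp U).restrictScalars ℝ) := by
  have h1 : η ^ 2 * (s * η ^ 2) = 1 := by rw [← hs]; ring
  rw [← conjHom_eq_conj, ← conjHom_eq_conj, ← conjHom_eq_conj, conjHom_comp, conjHom_comp, conjHom_comp, conjHom_comp]
  congr 1
  refine LinearMap.ext fun Φ => ?_
  simp only [LinearMap.comp_apply, LinearMap.smul_apply, LinearMap.restrictScalars_apply, LinearMap.map_smul_of_tower, smul_smul]
  rw [h1, one_smul]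

omit [CompleteSpace 𝔸] [Fintype ι] in
/-- under the convention `hη : etaS i = |c_f|⁻¹`: `(η : ℂ)⁻¹ = (|c_f| : ℂ)` and `|c_f|² = c_f²`. [cite: Balaban1985BackgroundPropagators, (3.3) pp.390–391, (3.39) p.397, bookkeeping] -/
theorem inv_etaS_coe_eq (hη : etaS i = |i.cf|⁻¹) : (((etaS i : ℝ) : ℂ))⁻¹ = ((|i.cf| : ℝ) : ℂ) ∧ |i.cf| ^ 2 = i.cf ^ 2 := by
  refine ⟨?_, sq_abs _⟩
  rw [← Complex.ofReal_inv, hη, inv_inv]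

end Algebra

/-! ## §2  The member (3.49)₄ majorant of `DPD*(U₁)`, composed by `ineq349_hom` -/

section Member

variable [Fintype (geo9K i).Site] [DecidableEq (geo9K i).Site] {Rr : ℝ} {Hp : Prop}
variable {B : B9.Backgrounds} (cfg : B.Cfg → CfgY 𝔸 i) (Gp : SiteOpY 𝔸 i) (parS : SiteParY 𝔸 i) {U₁ : B.Cfg}

set_option maxHeartbeats 3200000 in
/-- ★★★ **(3.49)₄ FOR THE MEMBER LETTER `DPD*(U₁)` FROM THE LETTERS' BLOCKS**: given the (3.42) blocks of `G′(U₁)` (`hE`), bi-contractive `parS (cfg U₁)`, the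
convention `η = |c_f|⁻¹`, a (3.48) block majorant of `conj b(s·(Q′G′²Q′*)⁻¹(U₁))` (`η⁴s = 1`), a common rate `δ ≤ δ_G, δ_X`, (2.61) at `(δ₀, β)` and the scale
transfers of `ℓ, ℓ², ℓ⁻⁴` at `(δ₀, α, Λ)` on the member geometry, and `ρ + (2α+β)δ₀ ≤ δ`:
`conj b((DPDsY i parS G′ (cfg U₁))^ℝ) ≺ κ₃₄₉·((geo9K i).len a ^ 2)⁻¹·e^{−ρ·d(a,y)}` over `(toB6 (geo9K i) Rr Hp, ιB∘blkV1)`,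
`κ₃₄₉ = kappa349 (M₂Σ‖b_j‖) ((d+1)·M₂Σ‖b_j‖·B_G) B₁ Λ (c₁ dB δ₀ β)` — r06's `ineq349_hom` conj. 4 at the member letters, the word identity, p38's relabel.
[cite: Balaban1985BackgroundPropagators, (3.49) p.399, (3.25) p.394, Thm 3.1 (3.42) p.397, Thm 3.2 (3.48) p.398, (3.21), (3.24) p.394, p.414; Balaban1984PropagatorsII, (2.51)–(2.55) p.232, Lemma 2.1 (2.60)–(2.61) p.234, (2.46) p.231] -/
theorem hasMajorant_conj_DPDsY_of_eBlockInv {BG δG : ℝ} (hE : EBlock (kernelFamilySInv i B cfg Gp parS) BG δG U₁) (hBG : 0 ≤ BG)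
    (ιB : BlkY i → IBondY i) (hι : ∀ s, β i.hN i.D i.hk (ιB s) = s)
    (hpar : ∀ z w : SiteY i, ‖(parS (cfg U₁) z w : 𝔸)‖ ≤ 1 ∧ ‖(((parS (cfg U₁) z w)⁻¹ : 𝔸ˣ) : 𝔸)‖ ≤ 1)
    {M₂ : ℝ} (hM₂ : 0 ≤ M₂) (hrepr : ∀ (v : 𝔸) (j : ι), |b.repr v j| ≤ M₂ * ‖v‖) (hη : etaS i = |i.cf|⁻¹)
    {s B₁ δX : ℝ} (hs : (etaS i ^ 2 * etaS i ^ 2) * s = 1) (hB₁ : 0 ≤ B₁)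
    (hCinv : HasMajorant (g := toB6 (geo9K i) Rr Hp) (fun q : BlkY i × ι => ιB q.1) (conj b (s • (XinvY i parS Gp (cfg U₁)).restrictScalars ℝ))
      (fun a a' => B₁ * ((geo9K i).len a ^ 4)⁻¹ * Real.exp (-(δX * (geo9K i).dist a a'))))
    (dB : ℕ) {δ₀ δ α β' ρ Λ : ℝ} (hΛ : 1 ≤ Λ) (hρ : 0 ≤ ρ) (hα : 0 ≤ α) (hβ : 0 ≤ β') (hδ₀ : 0 ≤ δ₀)
    (hδG' : δ ≤ δG) (hδX' : δ ≤ δX) (hr : ρ + (2 * α + β') * δ₀ ≤ δ)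
    (h261 : Ineq261 dB (toB6 (geo9K i) Rr Hp) δ₀ β')
    (hT1 : ScaleTransfer (geo9K i) δ₀ α Λ (fun a => (geo9K i).len a)) (hT2 : ScaleTransfer (geo9K i) δ₀ α Λ (fun a => (geo9K i).len a ^ 2))
    (hT4 : ScaleTransfer (geo9K i) δ₀ α Λ (fun a => ((geo9K i).len a ^ 4)⁻¹)) :
    HasMajorant (g := toB6 (geo9K i) Rr Hp) (fun p : FBondY i × ι => ιB (blkV1 i.hN i.D p.1))
      (conj b ((DPDsY i parS Gp (cfg U₁)).restrictScalars ℝ))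
      (fun a y => kappa349 (M₂ * ∑ j, ‖b j‖) (((d : ℝ) + 1) * (M₂ * (∑ j, ‖b j‖) * BG)) B₁ Λ (B6.c1 dB δ₀ β') *
        ((geo9K i).len a ^ 2)⁻¹ * Real.exp (-(ρ * (geo9K i).dist a y))) := by
  obtain ⟨htri, -, hdnn⟩ := geo9K_axioms i Rr Hp
  have hlen : ∀ y : (geo9K i).Site, 0 < (geo9K i).len y := B6KLevelCensusIndexV1.len_pos i
  have hSb : 0 ≤ ∑ j, ‖b j‖ := Finset.sum_nonneg fun _ _ => norm_nonneg _
  have hκQ : 0 ≤ M₂ * ∑ j, ‖b j‖ := mul_nonneg hM₂ hSb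
  have hK₀ : 0 ≤ M₂ * (∑ j, ‖b j‖) * BG := mul_nonneg hκQ hBG
  have hd1 : (1 : ℝ) ≤ (d : ℝ) + 1 := by linarith [(Nat.cast_nonneg d : (0 : ℝ) ≤ d)]
  have hB₀ : 0 ≤ ((d : ℝ) + 1) * (M₂ * (∑ j, ‖b j‖) * BG) := by positivity
  have hK₀B₀ : M₂ * (∑ j, ‖b j‖) * BG ≤ ((d : ℝ) + 1) * (M₂ * (∑ j, ‖b j‖) * BG) := by nlinarith
  -- the letter `G := η²G′(U₁)` in real coordinates and its three (3.42) entries at the common rate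
  set G₀ : Module.End ℝ (SiteY i → 𝔸) := (etaS i ^ 2) • (Gp (cfg U₁)).restrictScalars ℝ with hG₀def
  have hG₀ : ∀ Λm, G₀ Λm = (etaS i ^ 2) • Gp (cfg U₁) Λm := fun Λm => rfl
  have hG : HasMajorant (g := toB6 (geo9K i) Rr Hp) (fun p : SiteY i × ι => ιB (blkOf i.D.toDomains p.1)) (conj b G₀)
      (fun a a' => ((d : ℝ) + 1) * (M₂ * (∑ j, ‖b j‖) * BG) * (geo9K i).len a ^ 2 * Real.exp (-(δ * (geo9K i).dist a a'))) := by
    refine hasMajorant_mono (g := toB6 (geo9K i) Rr Hp) _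
      (hasMajorant_conj_G_of_eBlockInv i b cfg Gp parS hE hBG ιB hι hM₂ hrepr rfl G₀ hG₀) fun a a' => ?_
    calc M₂ * (∑ j, ‖b j‖) * BG * (geo9K i).len a ^ 2 * Real.exp (-(δG * (geo9K i).dist a a'))
        ≤ M₂ * (∑ j, ‖b j‖) * BG * (geo9K i).len a ^ 2 * Real.exp (-(δ * (geo9K i).dist a a')) :=
          kernel_rate_mono hdnn hδG' (mul_nonneg hK₀ (sq_nonneg _)) a a'
      _ ≤ ((d : ℝ) + 1) * (M₂ * (∑ j, ‖b j‖) * BG) * (geo9K i).len a ^ 2 * Real.exp (-(δ * (geo9K i).dist a a')) :=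
          mul_le_mul_of_nonneg_right (mul_le_mul_of_nonneg_right hK₀B₀ (sq_nonneg _)) (Real.exp_nonneg _)
  have hDG : HasMajorantHom (g := toB6 (geo9K i) Rr Hp) (fun p : SiteY i × ι => ιB (blkOf i.D.toDomains p.1))
      (fun q : (Fin (d + 1) × SiteY i) × ι => ιB (blkOf i.D.toDomains q.1.2))
      (conjHom b (gradLin (shiftY i) (((etaS i : ℝ) : ℂ))⁻¹ (UboxY i (cfg U₁))) ∘ₗ conj b G₀)
      (fun a a' => ((d : ℝ) + 1) * (M₂ * (∑ j, ‖b j‖) * BG) * (geo9K i).len a * Real.exp (-(δ * (geo9K i).dist a a'))) := by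
    refine hasMajorantHom_mono (g := toB6 (geo9K i) Rr Hp) _ _
      (hasMajorantHom_gradLin (g := geo9K i) (R := Rr) (H := Hp) b (shiftY i) (UboxY i (cfg U₁)) (fun z : SiteY i => ιB (blkOf i.D.toDomains z))
        (((etaS i : ℝ) : ℂ))⁻¹ fun μ => hasMajorant_gradF_mul_G_of_eBlockInv i b cfg Gp parS hE hBG ιB hι hM₂ hrepr rfl rfl G₀ hG₀ μ) fun a a' => ?_
    calc M₂ * (∑ j, ‖b j‖) * BG * (geo9K i).len a * Real.exp (-(δG * (geo9K i).dist a a'))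
        ≤ M₂ * (∑ j, ‖b j‖) * BG * (geo9K i).len a * Real.exp (-(δ * (geo9K i).dist a a')) :=
          kernel_rate_mono hdnn hδG' (mul_nonneg hK₀ (hlen a).le) a a'
      _ ≤ ((d : ℝ) + 1) * (M₂ * (∑ j, ‖b j‖) * BG) * (geo9K i).len a * Real.exp (-(δ * (geo9K i).dist a a')) :=
          mul_le_mul_of_nonneg_right (mul_le_mul_of_nonneg_right hK₀B₀ (hlen a).le) (Real.exp_nonneg _)
  have hGDs : HasMajorantHom (g := toB6 (geo9K i) Rr Hp) (fun q : (Fin (d + 1) × SiteY i) × ι => ιB (blkOf i.D.toDomains q.1.2))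
      (fun p : SiteY i × ι => ιB (blkOf i.D.toDomains p.1))
      (conj b G₀ ∘ₗ conjHom b (divLin (shiftY i) (((etaS i : ℝ) : ℂ))⁻¹ (UboxY i (cfg U₁))))
      (fun a a' => ((d : ℝ) + 1) * (M₂ * (∑ j, ‖b j‖) * BG) * (geo9K i).len a * Real.exp (-(δ * (geo9K i).dist a a'))) := by
    refine hasMajorantHom_mono (g := toB6 (geo9K i) Rr Hp) _ _
      (hasMajorantHom_divLin (g := geo9K i) (R := Rr) (H := Hp) b (shiftY i) (UboxY i (cfg U₁)) (fun z : SiteY i => ιB (blkOf i.D.toDomains z))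
        (((etaS i : ℝ) : ℂ))⁻¹ fun ν => hasMajorant_G_mul_gradB_of_eBlockInv i b cfg Gp parS hE hBG ιB hι hM₂ hrepr rfl rfl G₀ hG₀ ν) fun a a' => ?_
    have hcard : (Fintype.card (Fin (d + 1)) : ℝ) = (d : ℝ) + 1 := by rw [Fintype.card_fin]; push_cast; ring
    rw [hcard]
    calc ((d : ℝ) + 1) * (M₂ * (∑ j, ‖b j‖) * BG * (geo9K i).len a * Real.exp (-(δG * (geo9K i).dist a a')))
        ≤ ((d : ℝ) + 1) * (M₂ * (∑ j, ‖b j‖) * BG * (geo9K i).len a * Real.exp (-(δ * (geo9K i).dist a a'))) :=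
          mul_le_mul_of_nonneg_left (kernel_rate_mono hdnn hδG' (mul_nonneg hK₀ (hlen a).le) a a') (by positivity)
      _ = ((d : ℝ) + 1) * (M₂ * (∑ j, ‖b j‖) * BG) * (geo9K i).len a * Real.exp (-(δ * (geo9K i).dist a a')) := by ring
  have hCinv' : HasMajorant (g := toB6 (geo9K i) Rr Hp) (fun q : BlkY i × ι => ιB q.1) (conj b (s • (XinvY i parS Gp (cfg U₁)).restrictScalars ℝ))
      (fun a a' => B₁ * ((geo9K i).len a ^ 4)⁻¹ * Real.exp (-(δ * (geo9K i).dist a a'))) :=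
    hasMajorant_mono (g := toB6 (geo9K i) Rr Hp) _ hCinv fun a a' =>
      kernel_rate_mono hdnn hδX' (mul_nonneg hB₁ (inv_nonneg.2 (pow_nonneg (hlen a).le 4))) a a'
  -- r06's engine, conjunct 4, at the member letters
  have h4 := (ineq349_hom (R := Rr) (H := Hp) (fun p : SiteY i × ι => ιB (blkOf i.D.toDomains p.1))
    (fun q : (Fin (d + 1) × SiteY i) × ι => ιB (blkOf i.D.toDomains q.1.2)) (fun q : BlkY i × ι => ιB q.1) dB δ₀ δ α β' ρ Λ
    (M₂ * ∑ j, ‖b j‖) (((d : ℝ) + 1) * (M₂ * (∑ j, ‖b j‖) * BG)) B₁ hκQ hB₀ hB₁ hΛ hρ hα hβ hδ₀ hr hdnn htri hlen h261 hT1 hT2 hT4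
    (hasMajorantHom_conjHom_QpY i b ιB parS (cfg U₁) hpar hM₂ hrepr) (hasMajorantHom_conjHom_QpsY i b ιB parS (cfg U₁) hpar hM₂ hrepr)
    hG hDG hGDs hCinv').2.2.2
  -- the word IS `conj b((G′Q′*X⁻¹Q′G′)^ℝ)`; the derivative unit IS `|c_f|`; relabel to def-Y's bond carrier
  obtain ⟨hηC, hsq⟩ := inv_etaS_coe_eq i hη
  rw [hG₀def, pHatWordY_eq_conj i b parS Gp (cfg U₁) hs, hηC] at h4
  rw [DPDsY_eq_gradY_pWord_divY]
  exact hasMajorant_conj_gradMdiv_of_relabel b i (g := geo9K i) (Rr := Rr) (H := Hp) (fun z : SiteY i => ιB (blkOf i.D.toDomains z)) _ _ hsq h4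

end Member

/-! ## §3  Family 2 of (3.105), summed over the cover, at the ζ of record — `hP` SUPPLIED -/

section FamTwo

variable [Fintype (geo9K i).Site] [DecidableEq (geo9K i).Site]
variable {B : B9.Backgrounds} (cfg : B.Cfg → CfgY 𝔸 i) (Gp : SiteOpY 𝔸 i) (parS : SiteParY 𝔸 i) (par : Node00.BondParY 𝔸 i) {U₁ : B.Cfg}

set_option maxHeartbeats 3200000 in
/-- ★★★ **FAMILY 2 OF (3.105) SUMMED OVER THE COVER, AT THE ζ OF RECORD, WITH THE MEMBER P-WORD MAJORANT SUPPLIED**: p33's Z2-cover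
`hasMajorant_sum_famTwo_zetaY_of_eBlock` with `P := DPDsY i parS G′ (cfg U₁)` and `hP :=` §2 —
`Σ_□ conj b(((1 − M_{ζ_□})·DPD*(U₁)·(M_{h_□}·O_□(U₁)·M_{h_□}))^ℝ) ≺ 3·5^{d+1}·(κ₃₄₉·(M₂Σ‖b_j‖B_O)·Λ′·c₁(δ,1−ρ)·e^{−a_sep·δ·DsepT i})·e^{−ρδ·d}` over `(toB6 (geo9K i) Rr Hp, ιB∘blkV1)`,
modulo the letters' blocks (`hE`: (3.42) for `G′(U₁)`; `hEO`: the `O_□(U₁)`), `hCinv` ((3.48)), bi-contractive `parS`, `η = |c_f|⁻¹`, and the member (2.61) ∕ scale transfers.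
[cite: Balaban1985BackgroundPropagators, (3.105) p.414, (3.49) p.399, (3.25) p.394, (3.91) p.410, Cor. 3.6 p.408, (3.87) p.409, p.411 l.12–14, p.412 l.31–36; Balaban1984PropagatorsII, (2.83)–(2.85) pp.237–238, (2.51)–(2.55) p.232, Lemma 2.1 (2.61) p.234] -/
theorem hasMajorant_sum_famTwo_zetaY_closed {BG δG : ℝ} (hE : EBlock (kernelFamilySInv i B cfg Gp parS) BG δG U₁) (hBG : 0 ≤ BG)
    (Oc : ↥(cubes i.D.toDomains) → BondOpY 𝔸 i) {BO δ : ℝ} (hBO : 0 ≤ BO) (hδ : 0 < δ)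
    (hEO : ∀ c : ↥(cubes i.D.toDomains), EBlock (kernelFamilyBInv i B cfg (Oc c) par) BO δ U₁)
    (ιB : BlkY i → IBondY i) (hι : ∀ s, β i.hN i.D i.hk (ιB s) = s)
    (hpar : ∀ z w : SiteY i, ‖(parS (cfg U₁) z w : 𝔸)‖ ≤ 1 ∧ ‖(((parS (cfg U₁) z w)⁻¹ : 𝔸ˣ) : 𝔸)‖ ≤ 1)
    {M₂ : ℝ} (hM₂ : 0 ≤ M₂) (hrepr : ∀ (v : 𝔸) (j : ι), |b.repr v j| ≤ M₂ * ‖v‖) (hη : etaS i = |i.cf|⁻¹)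
    {s B₁ δX : ℝ} (hs : (etaS i ^ 2 * etaS i ^ 2) * s = 1) (hB₁ : 0 ≤ B₁) (Rr : ℝ) (Hp : Prop)
    (hCinv : HasMajorant (g := toB6 (geo9K i) Rr Hp) (fun q : BlkY i × ι => ιB q.1) (conj b (s • (XinvY i parS Gp (cfg U₁)).restrictScalars ℝ))
      (fun a a' => B₁ * ((geo9K i).len a ^ 4)⁻¹ * Real.exp (-(δX * (geo9K i).dist a a'))))
    (dB : ℕ) {δ₀ δP α β' ρP Λ : ℝ} (hΛ : 1 ≤ Λ) (hρP : 0 ≤ ρP) (hα : 0 ≤ α) (hβ : 0 ≤ β') (hδ₀ : 0 ≤ δ₀)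
    (hδG' : δP ≤ δG) (hδX' : δP ≤ δX) (hr : ρP + (2 * α + β') * δ₀ ≤ δP)
    (h261 : Ineq261 dB (toB6 (geo9K i) Rr Hp) δ₀ β')
    (hT1 : ScaleTransfer (geo9K i) δ₀ α Λ (fun a => (geo9K i).len a)) (hT2 : ScaleTransfer (geo9K i) δ₀ α Λ (fun a => (geo9K i).len a ^ 2))
    (hT4 : ScaleTransfer (geo9K i) δ₀ α Λ (fun a => ((geo9K i).len a ^ 4)⁻¹))
    (dB' : ℕ) {αst asep ρ Λ' : ℝ} (hΛ' : 0 ≤ Λ') (hasep : 0 ≤ asep) (hρ : 0 ≤ ρ) (hsplit : αst + asep + ρ ≤ ρP / δ)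
    (h261' : Ineq261 dB' (toB6 (geo9K i) Rr Hp) δ (1 - ρ)) (hST : ScaleTransfer (geo9K i) δ αst Λ' (fun a => (geo9K i).len a ^ 2)) :
    HasMajorant (g := toB6 (geo9K i) Rr Hp) (fun p : FBondY i × ι => ιB (blkV1 i.hN i.D p.1))
      (∑ c : ↥(cubes i.D.toDomains), conj b (((1 - cutMulY (𝔸 := 𝔸) (hBdY i (zetaY i c))) * DPDsY i parS Gp (cfg U₁) *
        (cutMulY (𝔸 := 𝔸) (hBdY i (hTY i c)) * Oc c (cfg U₁) * cutMulY (𝔸 := 𝔸) (hBdY i (hTY i c)))).restrictScalars ℝ))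
      (fun a b' => (3 * 5 ^ (d + 1)) *
        ((kappa349 (M₂ * ∑ j, ‖b j‖) (((d : ℝ) + 1) * (M₂ * (∑ j, ‖b j‖) * BG)) B₁ Λ (B6.c1 dB δ₀ β') * (M₂ * (∑ j, ‖b j‖) * BO) * Λ' *
          B6.c1 dB' δ (1 - ρ) * Real.exp (-(asep * δ * DsepT i))) * Real.exp (-(ρ * δ * (geo9K i).dist a b')))) := by
  have hKP : 0 ≤ kappa349 (M₂ * ∑ j, ‖b j‖) (((d : ℝ) + 1) * (M₂ * (∑ j, ‖b j‖) * BG)) B₁ Λ (B6.c1 dB δ₀ β') := kappa349_nonneg hB₁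
  have hP := hasMajorant_conj_DPDsY_of_eBlockInv i b cfg Gp parS hE hBG ιB hι hpar hM₂ hrepr hη hs hB₁ hCinv dB hΛ hρP hα hβ hδ₀ hδG' hδX' hr
    h261 hT1 hT2 hT4
  have hP' : HasMajorant (g := toB6 (geo9K i) Rr Hp) (fun p : FBondY i × ι => ιB (blkV1 i.hN i.D p.1))
      (conj b ((DPDsY i parS Gp (cfg U₁)).restrictScalars ℝ))
      (fun a y => kappa349 (M₂ * ∑ j, ‖b j‖) (((d : ℝ) + 1) * (M₂ * (∑ j, ‖b j‖) * BG)) B₁ Λ (B6.c1 dB δ₀ β') *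
        ((geo9K i).len a ^ 2)⁻¹ * Real.exp (-(ρP / δ * δ * (geo9K i).dist a y))) :=
    hasMajorant_mono (g := toB6 (geo9K i) Rr Hp) _ hP fun a y => le_of_eq (by rw [div_mul_cancel₀ _ hδ.ne'])
  exact hasMajorant_sum_famTwo_zetaY_of_eBlock i b cfg par Oc hBO hδ.le hEO hM₂ hrepr ιB hι Rr Hp (DPDsY i parS Gp (cfg U₁)) dB'
    hKP hΛ' hasep hρ hsplit h261' hST hP'

end FamTwo

/-! ## §4  The transposed family-2 word of `hV′` VANISHES at the ζ of record (`h_□·ζ_□̃ = h_□`) -/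

section FamTwoT

variable (c : ↥(cubes i.D.toDomains))

omit [CompleteSpace 𝔸] [Fintype ι] in
/-- ★ **`M_{h_□}·O·M_{h_□}·((1 − M_{ζ_□̃})·P) = 0`** — because `M_{h_□}·M_{ζ_□̃} = M_{h_□}` (`B9Eq3105ZetaY.cutMulY_hTY_mul_cutMulY_zetaY`; print p. 415 «ζ_□̃h_□ = h_□»).
[cite: Balaban1985BackgroundPropagators, (3.105) p.414, p.415, (3.87) p.409] -/
theorem famTwoT_zetaY_eq_zero (O P : (FBondY i → 𝔸) →ₗ[ℂ] (FBondY i → 𝔸)) :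
    cutMulY (𝔸 := 𝔸) (hBdY i (hTY i c)) * O * cutMulY (𝔸 := 𝔸) (hBdY i (hTY i c)) *
      ((1 - cutMulY (𝔸 := 𝔸) (hBdY i (zetaY i c))) * P) = 0 := by
  rw [sub_mul, one_mul, mul_sub, ← mul_assoc _ (cutMulY (𝔸 := 𝔸) (hBdY i (zetaY i c))) P,
    mul_assoc (cutMulY (𝔸 := 𝔸) (hBdY i (hTY i c)) * O) (cutMulY (𝔸 := 𝔸) (hBdY i (hTY i c))) (cutMulY (𝔸 := 𝔸) (hBdY i (zetaY i c))),
    B9Eq3105ZetaY.cutMulY_hTY_mul_cutMulY_zetaY, sub_self]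

/-- ★ the `hV′` family-2 summand is the ZERO operator at the ζ of record. [cite: Balaban1985BackgroundPropagators, (3.105) p.414, p.415] -/
theorem sum_famTwoT_zetaY_eq_zero (Oc : ↥(cubes i.D.toDomains) → BondOpY 𝔸 i) (P : (FBondY i → 𝔸) →ₗ[ℂ] (FBondY i → 𝔸)) (U : CfgY 𝔸 i) :
    (∑ c : ↥(cubes i.D.toDomains), conj b ((cutMulY (𝔸 := 𝔸) (hBdY i (hTY i c)) * Oc c U * cutMulY (𝔸 := 𝔸) (hBdY i (hTY i c)) *
        ((1 - cutMulY (𝔸 := 𝔸) (hBdY i (zetaY i c))) * P)).restrictScalars ℝ)) = 0 := by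
  refine Finset.sum_eq_zero fun c _ => ?_
  rw [famTwoT_zetaY_eq_zero, LinearMap.restrictScalars_zero, conj, map_zero]

/-- ★★ **THE TRANSPOSED FAMILY 2 OF `hV′` HAS EVERY NONNEGATIVE MAJORANT** (it is `0`) — in particular `θ·ℓ(a)·ℓ(a′)⁻¹·e^{−δd}` with `θ = 0`.
[cite: Balaban1985BackgroundPropagators, (3.105) p.414, p.415; Balaban1984PropagatorsII, (2.51) p.232] -/
theorem hasMajorant_sum_famTwoT_zetaY [Fintype (geo9K i).Site] (Rr : ℝ) (Hp : Prop) (ιB : BlkY i → IBondY i)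
    (Oc : ↥(cubes i.D.toDomains) → BondOpY 𝔸 i) (P : (FBondY i → 𝔸) →ₗ[ℂ] (FBondY i → 𝔸)) (U : CfgY 𝔸 i)
    {K : IBondY i → IBondY i → ℝ} (hK : ∀ a a', 0 ≤ K a a') :
    HasMajorant (g := toB6 (geo9K i) Rr Hp) (fun p : FBondY i × ι => ιB (blkV1 i.hN i.D p.1))
      (∑ c : ↥(cubes i.D.toDomains), conj b ((cutMulY (𝔸 := 𝔸) (hBdY i (hTY i c)) * Oc c U * cutMulY (𝔸 := 𝔸) (hBdY i (hTY i c)) *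
        ((1 - cutMulY (𝔸 := 𝔸) (hBdY i (zetaY i c))) * P)).restrictScalars ℝ)) K := by
  rw [sum_famTwoT_zetaY_eq_zero]
  exact hasMajorant_mono (g := toB6 (geo9K i) Rr Hp) _ (B6RandomWalk.hasMajorant_zero _) fun a a' => hK a a'

end FamTwoT

end Literature.MathematicalPhysics.QuantumFieldTheory.Balaban1983to89.B9Ineq349DPDsYOfEBlock

end
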